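import Literature.AnabelianGeometry.SemiGraphs.TemperedDLocCategory

/-!
# Transport of `DLoc_{G_K}(Π^temp_{X_K})` along an isomorphism `α : Π^temp_{X_K} ⥲ Π^temp_{Y_L}` ([SemiAnbd] Thm. 6.8 (ii))

Mochizuki, *Semi-graphs of anabelioids*, Publ. RIMS **42** (2006) [SemiAnbd], §6, Theorem 6.8
(ii), author's manuscript p. 74: "Every isomorphism of tempered groups `α : Π^temp_{X_K} ⥲ Π^temp_{Y_L}`
induces an equivalence of categories `DLoc_{G_K}(Π^temp_{X_K}) ⥲ DLoc_{G_L}(Π^temp_{Y_L})` …".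
In print this clause "follows … formally from the definition of the categories" once one knows that
`α` preserves the geometric subgroups `Δ^temp` and the cuspidal geometric decomposition groups
([Mzk8] = *Galois sections in absolute anabelian geometry*, proof of Thm. 2.3 (ii): "in light of
Proposition 1.1, (ii); Theorem 1.3, (iii)"; tempered version [SemiAnbd] p. 75 "by exactly the same
arguments", with [SemiAnbd] Thm. 6.5 (iii) in the rôle of [Mzk8] Thm. 1.3 (iii)).
[cite: MochizukiSemiAnbd2006, Thm 6.8(ii) p.74]

This file CARRIES OUT that formal argument over the genuine category `DLocObj.dlocCategory`
(`TemperedDLocCategory.lean`; cell abc-iut, layer L3, seat abc-iut-L3-t4 gen 3): given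
`α : Π^temp_{X_K} ⥲ Π^temp_{Y_L}` with (hΔ) `α(Δ^temp_X) = Δ^temp_Y` and (hI) "`I ⊆ Π^temp_{X_K}` is a
cuspidal geometric decomposition group iff `α(I)` is" (= [SemiAnbd] Thm. 6.5 (iii) for `α` and
`α⁻¹`, typed as `TemperedCurve.IsoPreservesCuspidalDecomp`), it constructs the transported object
`(α(H) ↠ α(H)/α(N))` (`DLocObj.transport`), the induced isomorphism `J ⥲ J'` (`DLocObj.jIso`), the
transport of morphisms (outer DOF-type homomorphisms over `G_K` go to outer DOF-type homomorphisms
over `G_L`, the compatibility element `g ∈ G_K` being replaced by its image under the isomorphism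
`G_K ⥲ G_L` induced by `α` — this is where (hΔ) enters), the transport functor and the transport
EQUIVALENCE `DLoc_{G_K}(Π^temp_{X_K}) ≌ DLoc_{G_L}(Π^temp_{Y_L})` (`DLocObj.transportEquivalence`), and
PROVES the equivalence clause of Thm. 6.8 (ii) in its typed form
`TemperedCurve.IsoInducesDLocEquivalence X Y DX.toDLocContext DY.toDLocContext α` for all
genuine-morphism contexts, modulo (hΔ) and (hI) (`isoInducesDLocEquivalence_of`).  Typed ≠ endorsed;
nothing here takes a side on [IUTchIII] Cor. 3.12.
-/

noncomputable section

namespace Literature.AnabelianGeometry.SemiGraphs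

open scoped Pointwise
open CategoryTheory Topology

variable {p : ℕ} [Fact p.Prime]

namespace DLocObj

variable {X Y : TemperedCurve p}

/-! ### Restricting `α` to a subgroup -/

/-- The isomorphism of topological groups `H ⥲ α(H)` obtained by restricting `α`.
[cite: MochizukiSemiAnbd2006, Thm 6.8(ii) p.74] -/
def subgroupIso (α : X.PiTemp ≃ₜ* Y.PiTemp) (H : Subgroup X.PiTemp) :
    H ≃ₜ* H.map α.toMulEquiv.toMonoidHom where
  toMulEquiv := α.toMulEquiv.subgroupMap H
  continuous_toFun :=
    continuous_induced_rng.2 (by exact α.continuous.comp continuous_subtype_val)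
  continuous_invFun :=
    continuous_induced_rng.2 (by exact α.symm.continuous.comp continuous_subtype_val)

/-- `subgroupIso α H` is `α` on underlying elements. [cite: MochizukiSemiAnbd2006, Thm 6.8(ii) p.74] -/
@[simp] theorem coe_subgroupIso_apply (α : X.PiTemp ≃ₜ* Y.PiTemp) (H : Subgroup X.PiTemp) (h : H) :
    ((subgroupIso α H h : H.map α.toMulEquiv.toMonoidHom) : Y.PiTemp) = α (h : X.PiTemp) := rfl

/-- `subtype ∘ subgroupIso = α ∘ subtype` at the level of subgroups: for `K ⊆ H`,
`α(K) = (subgroupIso K)` viewed in `Π^temp_{Y_L}`. [cite: MochizukiSemiAnbd2006, Thm 6.8(ii) p.74] -/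
theorem map_subtype_map_subgroupIso (α : X.PiTemp ≃ₜ* Y.PiTemp) (H : Subgroup X.PiTemp)
    (K : Subgroup H) :
    (K.map (subgroupIso α H).toMulEquiv.toMonoidHom).map (H.map α.toMulEquiv.toMonoidHom).subtype =
      (K.map H.subtype).map α.toMulEquiv.toMonoidHom := by
  ext y
  constructor
  · rintro ⟨_, ⟨k, hk, rfl⟩, rfl⟩
    exact ⟨k, ⟨k, hk, rfl⟩, rfl⟩
  · rintro ⟨_, ⟨k, hk, rfl⟩, rfl⟩
    exact ⟨subgroupIso α H k, ⟨k, hk, rfl⟩, rfl⟩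

/-- Topological closure commutes with isomorphisms of topological groups.
[cite: MochizukiSemiAnbd2006, Thm 6.8(ii) p.74] -/
theorem map_topologicalClosure_equiv {G G' : Type*} [Group G] [TopologicalSpace G]
    [IsTopologicalGroup G] [Group G'] [TopologicalSpace G'] [IsTopologicalGroup G'] (e : G ≃ₜ* G')
    (K : Subgroup G) :
    K.topologicalClosure.map e.toMulEquiv.toMonoidHom = (K.map e.toMulEquiv.toMonoidHom).topologicalClosure := by
  apply SetLike.coe_injective
  rw [Subgroup.coe_map, Subgroup.topologicalClosure_coe, Subgroup.topologicalClosure_coe,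
    Subgroup.coe_map]
  exact e.toHomeomorph.image_closure (K : Set G)

/-! ### Transport of objects -/

section Transport

variable (α : X.PiTemp ≃ₜ* Y.PiTemp)
  (hI : ∀ I : Subgroup X.PiTemp, X.IsCuspidalGeometricDecompositionGroup I →
    Y.IsCuspidalGeometricDecompositionGroup (I.map α.toMulEquiv.toMonoidHom))

/-- The image under `subgroupIso α H` of the generating set `⋃_{I ∈ gens} (I ∩ H ⊆ H)` is the
generating set of the transported object. [cite: MochizukiSemiAnbd2006, Thm 6.8(ii) p.74] -/
theorem image_subgroupIso_gens (A : DLocObj X) :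
    (subgroupIso α A.H) '' (⋃ I ∈ A.gens, ((I.subgroupOf A.H : Subgroup A.H) : Set A.H)) =
      ⋃ I ∈ (fun I : Subgroup X.PiTemp => I.map α.toMulEquiv.toMonoidHom) '' A.gens,
        ((I.subgroupOf (A.H.map α.toMulEquiv.toMonoidHom) :
          Subgroup (A.H.map α.toMulEquiv.toMonoidHom)) : Set (A.H.map α.toMulEquiv.toMonoidHom)) := by
  ext y
  simp only [Set.mem_image, Set.mem_iUnion, SetLike.mem_coe, Subgroup.mem_subgroupOf,
    exists_prop]
  constructor
  · rintro ⟨h, ⟨I, hI', hh⟩, rfl⟩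
    exact ⟨I.map α.toMulEquiv.toMonoidHom, ⟨I, hI', rfl⟩, ⟨h, hh, rfl⟩⟩
  · rintro ⟨_, ⟨I, hI', rfl⟩, ⟨h, hh, hhy⟩⟩
    refine ⟨(subgroupIso α A.H).symm y, ⟨I, hI', ?_⟩, (subgroupIso α A.H).apply_symm_apply y⟩
    have : ((subgroupIso α A.H).symm y : X.PiTemp) = h := by
      change α.symm (y : Y.PiTemp) = (h : X.PiTemp)
      rw [← hhy]; exact α.symm_apply_apply (h : X.PiTemp)
    rw [this]; exact hh

/-- **Transport of an object** of `DLoc_{G_K}(Π^temp_{X_K})` along `α`: `(H ↠ J) ↦ (α(H) ↠ α(H)/α(N))`,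
the generating cuspidal geometric decomposition groups being carried to cuspidal geometric
decomposition groups of `Π^temp_{Y_L}` by (hI) ([SemiAnbd] Thm. 6.5 (iii)) and hyperbolicity being
preserved because `α(Δ^temp_X) = Δ^temp_Y` (hΔ). [cite: MochizukiSemiAnbd2006, Thm 6.8(ii) p.74] -/
def transport (hΔ : X.DeltaTemp.map α.toMulEquiv.toMonoidHom = Y.DeltaTemp) (A : DLocObj X) :
    DLocObj Y where
  H := A.H.map α.toMulEquiv.toMonoidHom
  isOpen_H := by
    rw [Subgroup.coe_map]
    exact α.toHomeomorph.isOpenMap _ A.isOpen_H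
  finiteIndex_H := by
    haveI := A.finiteIndex_H
    exact ⟨by
      rw [Subgroup.index_map_of_bijective (f := α.toMulEquiv.toMonoidHom) α.bijective]
      exact Subgroup.FiniteIndex.index_ne_zero⟩
  gens := (fun I : Subgroup X.PiTemp => I.map α.toMulEquiv.toMonoidHom) '' A.gens
  gens_cuspidal := by
    rintro _ ⟨I, hI', rfl⟩
    obtain ⟨I₀, h₀, rfl⟩ := A.gens_cuspidal I hI'
    exact ⟨I₀.map α.toMulEquiv.toMonoidHom, hI I₀ h₀,
      Subgroup.map_inf _ _ _ α.injective⟩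
  N := A.N.map α.toMulEquiv.toMonoidHom
  N_eq := by
    rw [A.N_eq, ← map_subtype_map_subgroupIso, map_topologicalClosure_equiv,
      Subgroup.map_normalClosure _ _ (subgroupIso α A.H).surjective]
    congr 3
    exact image_subgroupIso_gens α A
  hyperbolic := by
    intro h
    apply A.hyperbolic
    intro a ha b hb
    have hmem : ∀ c ∈ X.DeltaTemp ⊓ A.H, α c ∈ Y.DeltaTemp ⊓ A.H.map α.toMulEquiv.toMonoidHom := by
      intro c hc
      rw [← hΔ, ← Subgroup.map_inf _ _ _ α.injective]
      exact ⟨c, hc, rfl⟩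
    have := h (α a) (hmem a ha) (α b) (hmem b hb)
    rw [← map_inv, ← map_inv, ← map_mul, ← map_mul, ← map_mul] at this
    obtain ⟨c, hc, hcc⟩ := this
    rwa [← α.injective hcc]

end Transport

/-! ### The induced isomorphism `J ⥲ J'` -/

section JIso

variable (α : X.PiTemp ≃ₜ* Y.PiTemp)
  (hI : ∀ I : Subgroup X.PiTemp, X.IsCuspidalGeometricDecompositionGroup I →
    Y.IsCuspidalGeometricDecompositionGroup (I.map α.toMulEquiv.toMonoidHom))
  (hΔ : X.DeltaTemp.map α.toMulEquiv.toMonoidHom = Y.DeltaTemp)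

/-- `subgroupIso α H` carries `N ∩ H` onto `α(N) ∩ α(H)`. [cite: MochizukiSemiAnbd2006, Thm 6.8(ii) p.74] -/
theorem map_subgroupIso_NH (A : DLocObj X) :
    A.NH.map (subgroupIso α A.H).toMulEquiv.toMonoidHom = (A.transport α hI hΔ).NH := by
  rw [NH_eq, NH_eq]
  ext y
  simp only [Subgroup.mem_map, Subgroup.mem_subgroupOf]
  constructor
  · rintro ⟨x, hx, rfl⟩
    exact ⟨x, hx, rfl⟩
  · rintro ⟨x, hx, hxy⟩
    exact ⟨⟨x, A.N_le_H hx⟩, hx, Subtype.ext hxy⟩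

/-- **The isomorphism of tempered groups `J ⥲ J' = α(H)/α(N)`** induced by `α` on an object
`H ↠ J`. [cite: MochizukiSemiAnbd2006, Thm 6.8(ii) p.74] -/
def jIso (A : DLocObj X) : A.J ≃ₜ* (A.transport α hI hΔ).J where
  toMulEquiv := QuotientGroup.congr A.NH (A.transport α hI hΔ).NH (subgroupIso α A.H).toMulEquiv
    (map_subgroupIso_NH α hI hΔ A)
  continuous_toFun := by
    refine (QuotientGroup.isQuotientMap_mk A.NH).continuous_iff.2 ?_
    exact QuotientGroup.continuous_mk.comp (subgroupIso α A.H).continuous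
  continuous_invFun := by
    refine (QuotientGroup.isQuotientMap_mk _).continuous_iff.2 ?_
    exact QuotientGroup.continuous_mk.comp (subgroupIso α A.H).symm.continuous

/-- `jIso` on the class of `h ∈ H` is the class of `α(h)`. [cite: MochizukiSemiAnbd2006, Thm 6.8(ii) p.74] -/
@[simp] theorem jIso_mk (A : DLocObj X) (h : A.H) :
    jIso α hI hΔ A (QuotientGroup.mk h) = QuotientGroup.mk (subgroupIso α A.H h) := rfl

/-- `J' → G_L` on the image of `h ∈ H` is `aug_Y(α(h))`. [cite: MochizukiSemiAnbd2006, Thm 6.8(ii) p.74] -/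
theorem augJ_transport_jIso_mk (A : DLocObj X) (h : A.H) :
    (A.transport α hI hΔ).augJ (jIso α hI hΔ A (QuotientGroup.mk h)) = Y.aug (α (h : X.PiTemp)) :=
  rfl

include hΔ in
/-- (hΔ) makes `aug_Y ∘ α` factor through `aug_X`: elements with the same image in `G_K` have images
under `α` with the same image in `G_L` (the isomorphism `G_K ⥲ G_L` induced by `α`).
[cite: MochizukiSemiAnbd2006, Thm 6.8(ii) p.74] -/
theorem aug_apply_eq_of_aug_eq {x x' : X.PiTemp} (h : X.aug x = X.aug x') :
    Y.aug (α x) = Y.aug (α x') := by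
  have hx : x⁻¹ * x' ∈ X.DeltaTemp := by
    change X.aug (x⁻¹ * x') = 1
    rw [map_mul, map_inv, h, inv_mul_cancel]
  have hy : α (x⁻¹ * x') ∈ Y.DeltaTemp := by
    rw [← hΔ]; exact ⟨_, hx, rfl⟩
  change Y.aug (α (x⁻¹ * x')) = 1 at hy
  rw [map_mul, map_inv, map_mul, map_inv] at hy
  exact inv_mul_eq_one.1 hy

/-! ### Transport of morphisms and the transport functor -/

/-- **Transport of a morphism**: `φ : J₁ → J₂` goes to `J₁' ⥲ J₁ → J₂ ⥲ J₂'`; it is of DOF-type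
(`DOFTypeHomComposition.lean`) and compatible with the outer homomorphisms to `G_L`, the
compatibility element `g = aug_X(x₀) ∈ G_K` being replaced by `aug_Y(α(x₀)) ∈ G_L` (via (hΔ)).
[cite: MochizukiSemiAnbd2006, Thm 6.8(ii) p.74] -/
def HomRep.transport {A B : DLocObj X} (φ : HomRep A B) :
    HomRep (A.transport α hI hΔ) (B.transport α hI hΔ) where
  toHom := (jIso α hI hΔ B : B.J →ₜ* (B.transport α hI hΔ).J).comp
    (φ.toHom.comp ((jIso α hI hΔ A).symm : (A.transport α hI hΔ).J →ₜ* A.J))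
  isDOFTypeHom :=
    (isDOFTypeHom_of_surjective _ (jIso α hI hΔ B).surjective).comp
      (φ.isDOFTypeHom.comp (isDOFTypeHom_of_surjective _ (jIso α hI hΔ A).symm.surjective))
  compat := by
    obtain ⟨g, hg, hφ⟩ := φ.compat
    have hg' : g ∈ X.aug.toMonoidHom.range := by rw [X.range_aug]; exact hg
    obtain ⟨x₀, rfl⟩ := hg'
    refine ⟨Y.aug (α x₀), ?_, fun j' => ?_⟩
    · change Y.aug (α x₀) ∈ Y.K.fixingSubgroup
      rw [← Y.range_aug]
      exact ⟨α x₀, rfl⟩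
    · obtain ⟨j, rfl⟩ := (jIso α hI hΔ A).surjective j'
      obtain ⟨h, rfl⟩ := QuotientGroup.mk_surjective j
      obtain ⟨b, hb⟩ := QuotientGroup.mk_surjective (φ.toHom (QuotientGroup.mk h))
      have key : X.aug (b : X.PiTemp) = X.aug (x₀ * h * x₀⁻¹) := by
        have := hφ (QuotientGroup.mk h)
        rw [← hb] at this
        change X.aug (b : X.PiTemp) = X.aug x₀ * X.aug (h : X.PiTemp) * (X.aug x₀)⁻¹ at this
        rw [this, map_mul, map_mul, map_inv]
      have lhs : (B.transport α hI hΔ).augJ (((jIso α hI hΔ B : B.J →ₜ* (B.transport α hI hΔ).J).comp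
          (φ.toHom.comp ((jIso α hI hΔ A).symm : (A.transport α hI hΔ).J →ₜ* A.J)))
          (jIso α hI hΔ A (QuotientGroup.mk h))) = Y.aug (α (b : X.PiTemp)) := by
        simp only [ContinuousMonoidHom.coe_comp, Function.comp_apply,
          ContinuousMonoidHom.coe_coe, ContinuousMulEquiv.symm_apply_apply]
        rw [← hb]
        rfl
      rw [lhs, aug_apply_eq_of_aug_eq α hΔ key, map_mul, map_mul, map_inv, map_mul, map_mul,
        map_inv]
      rfl

/-- The underlying map of the transported representative. [cite: MochizukiSemiAnbd2006, Thm 6.8(ii) p.74] -/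
@[simp] theorem HomRep.transport_toHom_apply {A B : DLocObj X} (φ : HomRep A B)
    (j' : (A.transport α hI hΔ).J) :
    (φ.transport α hI hΔ).toHom j' = jIso α hI hΔ B (φ.toHom ((jIso α hI hΔ A).symm j')) := rfl

/-- Transport of morphisms respects the outer-homomorphism relation.
[cite: MochizukiSemiAnbd2006, Thm 6.8(ii) p.74] -/
theorem HomRep.transport_rel {A B : DLocObj X} {φ ψ : HomRep A B} (h : (HomRep.setoid A B).r φ ψ) :
    (HomRep.setoid _ _).r (φ.transport α hI hΔ) (ψ.transport α hI hΔ) := by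
  obtain ⟨b, hb⟩ := h
  refine ⟨jIso α hI hΔ B b, fun j' => ?_⟩
  change jIso α hI hΔ B (ψ.toHom ((jIso α hI hΔ A).symm j')) =
    _ * jIso α hI hΔ B (φ.toHom ((jIso α hI hΔ A).symm j')) * _
  rw [hb, map_mul, map_mul, map_inv]

/-- Transport on morphisms `Hom A B → Hom A' B'`. [cite: MochizukiSemiAnbd2006, Thm 6.8(ii) p.74] -/
def Hom.transport {A B : DLocObj X} : Hom A B → Hom (A.transport α hI hΔ) (B.transport α hI hΔ) :=
  Quotient.map (HomRep.transport α hI hΔ) fun _ _ h => HomRep.transport_rel α hI hΔ h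

/-- **The transport functor** `DLoc_{G_K}(Π^temp_{X_K}) ⥤ DLoc_{G_L}(Π^temp_{Y_L})` induced by `α`
(Thm. 6.8 (ii): "induces"). [cite: MochizukiSemiAnbd2006, Thm 6.8(ii) p.74] -/
def transportFunctor :
    letI := dlocCategory X; letI := dlocCategory Y; DLocObj X ⥤ DLocObj Y :=
  letI := dlocCategory X; letI := dlocCategory Y
  { obj := fun A => A.transport α hI hΔ
    map := fun f => Hom.transport α hI hΔ f
    map_id := by
      intro A
      exact Quotient.sound ⟨1, fun j => by simp [HomRep.transport, HomRep.id]⟩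
    map_comp := by
      rintro A B C ⟨φ⟩ ⟨ψ⟩
      exact Quotient.sound ⟨1, fun j => by simp [HomRep.transport, HomRep.comp]⟩ }

/-- The transport functor on objects. [cite: MochizukiSemiAnbd2006, Thm 6.8(ii) p.74] -/
@[simp] theorem transportFunctor_obj (A : DLocObj X) :
    letI := dlocCategory X; letI := dlocCategory Y
    (transportFunctor α hI hΔ).obj A = A.transport α hI hΔ := rfl

end JIso

end DLocObj

end Literature.AnabelianGeometry.SemiGraphs

end
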